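import Summits.AtomisticToContinuum.BoseEinsteinCondensation.Theorems.BECCellInformationOneBodyEntropyBoundDenseCellTools
import Summits.AtomisticToContinuum.BoseEinsteinCondensation.Theorems.BECCellInformationOneBodyEntropyBoundFibreCaging
import Summits.AtomisticToContinuum.BoseEinsteinCondensation.Theorems.BECCellInformationOneBodyEntropyBoundBlockMass
import Summits.AtomisticToContinuum.BoseEinsteinCondensation.Theorems.BECCellInformationOneBodyEntropyBoundSymmCount

/-!
# Crux `OneBodyEntropyBound` — line `registered`, lead's stub `stub_denseCellBound`, part 2b:
# the densest-cell assembly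

Support file (`--supports stmt-AtomisticToContinuum-13440`, lead c2). From the one-particle local energy bound
(`DenseCell.local_energy_bound`, part 1b), the fibrewise caging bound (`stub_fibreCaging`), Bose symmetry with the
isolated-point count (`stub_symmCount`), and the `3×3×3` block bound (`stub_blockMass`), the coarse occupation-law entropy
bound follows for every pair potential `v` that is not a.e. zero and satisfies the insertion bound `E₀(n+1,L) ≤ E₀(n,L) + κ`
(`κ → 0` with `ρ`), given the Dirichlet floor, the one-body caging bound and the cutoff pair / count: at the DENSEST cell
`A` of the tiling, `β((n+1)P_A − γ) ≤ (n+1)δ + 27(κ + 3G)(n+1)P_A` forces `(n+1)P_A ≤ 2(1+γ)` uniformly in `n`, whence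
`Σ_k M⁻³ klFun(M³ P_k) ≤ max(log Λ, 0) + 1` (`denseCell_core`; the registered stub `stub_denseCellBound` is its
specialisation to the landed helper stubs).
-/

noncomputable section

namespace Summit.AtomisticToContinuum.BoseEinsteinCondensation.Cruxes.OneBodyEntropyBound.Birth

namespace DenseCell

open MeasureTheory Filter Topology
open scoped ENNReal NNReal
open Literature.MathematicalPhysics.QuantumManyBody.BoseGas InformationTheory
open Summit.AtomisticToContinuum.BoseEinsteinCondensation.Theorems

variable {n : ℕ} {L : ℝ}

/-! ### The densest-cell assembly -/

/-- **Dense-cell bound, core** (all ingredients as hypotheses: the one-particle local energy bound, the fibrewise caging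
bound, Bose symmetry with the isolated-point count, the block bound; the Dirichlet floor, the caging bound, the cutoff pair
and count; and, for the potential `v`, non-triviality and the insertion bound). Conclusion: the coarse occupation-law
entropy bound for `v`. [folklore] -/
theorem denseCell_core
    (hLEB : ∀ (n : ℕ) (L : ℝ) (v : ℝ → ENNReal), Measurable v →
      (∀ f : Config (n + 1) → ℂ, ContDiff ℝ 1 f → (∀ X, X ∉ boxN (n + 1) L → f X = 0) →
        groundStateEnergy v (n + 1) L * ∫⁻ X, (‖f X‖₊ : ENNReal) ^ 2 ≤
          ∫⁻ X, (kineticDensity f X + interaction v X * (‖f X‖₊ : ENNReal) ^ 2)) →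
      ∀ (χ η : EuclideanSpace ℝ (Fin 3) → ℝ), ContDiff ℝ 1 χ → ContDiff ℝ 1 η → (∀ x, χ x ^ 2 + η x ^ 2 = 1) →
      ∀ (G : ℝ), (∀ x, ‖fderiv ℝ χ x‖ ^ 2 + ‖fderiv ℝ η x‖ ^ 2 ≤ G) →
      ∀ (B : Set (EuclideanSpace ℝ (Fin 3))), (∀ x, x ∉ B → χ x = 0 ∧ fderiv ℝ χ x = 0 ∧ fderiv ℝ η x = 0) →
      ∀ (T : Set (EuclideanSpace ℝ (Fin 3))), (∀ x ∈ T, χ x = 1) →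
      ∀ (κ δ : ENNReal), groundStateEnergy v (n + 1) L ≠ ⊤ →
        groundStateEnergy v (n + 1) L ≤ groundStateEnergy v n L + κ →
        ∀ Ψ : TrialState (n + 1) L, energy v Ψ ≤ groundStateEnergy v (n + 1) L + δ →
          ∫⁻ X, T.indicator (fun _ => (1 : ENNReal)) (X 0) *
              (partialGradSq 0 Ψ.ψ X + (∑ j : Fin n, v (dist (X 0) (X j.succ))) * (‖Ψ.ψ X‖₊ : ENNReal) ^ 2) ≤
            δ + (κ + ENNReal.ofReal (3 * G)) *
              ∫⁻ X, B.indicator (fun _ => (1 : ENNReal)) (X 0) * (‖Ψ.ψ X‖₊ : ENNReal) ^ 2)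
    (hfib : ∀ (v : ℝ → ENNReal), Measurable v → ∀ (R β : ℝ), 0 < R → 0 < β →
      (∀ (m : ℕ) (Y : Fin m → EuclideanSpace ℝ (Fin 3)) (S : Finset (Fin m))
          (T : Set (EuclideanSpace ℝ (Fin 3))), MeasurableSet T →
          (∀ j ∈ S, Metric.ball (Y j) (7 * R) ⊆ T) →
          ∀ φ : EuclideanSpace ℝ (Fin 3) → ℂ, ContDiff ℝ 1 φ → HasCompactSupport φ →
            ENNReal.ofReal β * ∫⁻ x in ⋃ j ∈ S, Metric.ball (Y j) R, (‖φ x‖₊ : ENNReal) ^ 2 ≤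
              ∫⁻ x in T, ((∑ k : Fin 3, (‖fderiv ℝ φ x (EuclideanSpace.single k (1 : ℝ))‖₊ : ENNReal) ^ 2) +
                (∑ j ∈ S, v (dist x (Y j))) * (‖φ x‖₊ : ENNReal) ^ 2)) →
      ∀ (n : ℕ) (L : ℝ) (Ψ : TrialState (n + 1) L) (A T : Set (EuclideanSpace ℝ (Fin 3))),
        MeasurableSet A → MeasurableSet T → (∀ y ∈ A, Metric.ball y (7 * R) ⊆ T) →
        ENNReal.ofReal β * ∫⁻ X : Config (n + 1),
            ({X : Config (n + 1) | X 0 ∈ A ∧ ∃ j : Fin n, X j.succ ∈ A ∧ dist (X 0) (X j.succ) < R}).indicator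
              (fun _ => (1 : ENNReal)) X * (‖Ψ.ψ X‖₊ : ENNReal) ^ 2 ≤
          ∫⁻ X : Config (n + 1), T.indicator (fun _ => (1 : ENNReal)) (X 0) *
              (partialGradSq 0 Ψ.ψ X + (∑ j : Fin n, v (dist (X 0) (X j.succ))) * (‖Ψ.ψ X‖₊ : ENNReal) ^ 2))
    (hsym : ∀ (n : ℕ) (L : ℝ) (Ψ : TrialState (n + 1) L) (A : Set (EuclideanSpace ℝ (Fin 3))), MeasurableSet A →
      ∀ (R γ : ℝ), 0 ≤ γ →
      (∀ X : Config (n + 1), (∑ i : Fin (n + 1),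
          ({X : Config (n + 1) | X i ∈ A ∧ ∀ i' : Fin (n + 1), i' ≠ i → X i' ∈ A → R ≤ dist (X i) (X i')}).indicator
            (fun _ => (1 : ENNReal)) X) ≤ ENNReal.ofReal γ) →
      ((n + 1 : ℕ) : ENNReal) * ∫⁻ X : Config (n + 1), A.indicator (fun _ => (1 : ENNReal)) (X 0) * (‖Ψ.ψ X‖₊ : ENNReal) ^ 2 ≤
        (((n + 1 : ℕ) : ENNReal) * ∫⁻ X : Config (n + 1),
          ({X : Config (n + 1) | X 0 ∈ A ∧ ∃ j : Fin n, X j.succ ∈ A ∧ dist (X 0) (X j.succ) < R}).indicator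
            (fun _ => (1 : ENNReal)) X * (‖Ψ.ψ X‖₊ : ENNReal) ^ 2) + ENNReal.ofReal γ)
    (hblk : ∀ (n : ℕ) (L s : ℝ), 0 < s → ∀ (M : ℕ), (M : ℝ) * s = L →
      ∀ (Ψ : TrialState (n + 1) L) (k₀ : Fin 3 → Fin M) (P : ENNReal),
        (∀ k : Fin 3 → Fin M, ∫⁻ X : Config (n + 1),
            ({y : EuclideanSpace ℝ (Fin 3) | ∀ j, y j ∈ Set.Ico (((k j : ℕ) : ℝ) * s) ((((k j : ℕ) : ℝ) + 1) * s)}).indicator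
              (fun _ => (1 : ENNReal)) (X 0) * (‖Ψ.ψ X‖₊ : ENNReal) ^ 2 ≤ P) →
        ∫⁻ X : Config (n + 1),
            ({y : EuclideanSpace ℝ (Fin 3) | ∀ j, y j ∈ Set.Ioo (((k₀ j : ℕ) : ℝ) * s - s) (((k₀ j : ℕ) : ℝ) * s + 2 * s)}).indicator
              (fun _ => (1 : ENNReal)) (X 0) * (‖Ψ.ψ X‖₊ : ENNReal) ^ 2 ≤ 27 * P)
    (hfloor : ∀ (N : ℕ) (L : ℝ) (v : ℝ → ENNReal), Measurable v →
      ∀ f : Config N → ℂ, ContDiff ℝ 1 f → (∀ X, X ∉ boxN N L → f X = 0) →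
        groundStateEnergy v N L * ∫⁻ X, (‖f X‖₊ : ENNReal) ^ 2 ≤
          ∫⁻ X, (kineticDensity f X + interaction v X * (‖f X‖₊ : ENNReal) ^ 2))
    (hcage : ∀ v : ℝ → ENNReal, Measurable v →
      (¬ ∀ᵐ r : ℝ ∂(MeasureTheory.volume.restrict (Set.Ioi (0 : ℝ))), v r = 0) →
      ∃ R : ℝ, 0 < R ∧ ∃ β : ℝ, 0 < β ∧
        ∀ (m : ℕ) (Y : Fin m → EuclideanSpace ℝ (Fin 3)) (S : Finset (Fin m))
          (T : Set (EuclideanSpace ℝ (Fin 3))), MeasurableSet T →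
          (∀ j ∈ S, Metric.ball (Y j) (7 * R) ⊆ T) →
          ∀ φ : EuclideanSpace ℝ (Fin 3) → ℂ, ContDiff ℝ 1 φ → HasCompactSupport φ →
            ENNReal.ofReal β * ∫⁻ x in ⋃ j ∈ S, Metric.ball (Y j) R, (‖φ x‖₊ : ENNReal) ^ 2 ≤
              ∫⁻ x in T, ((∑ k : Fin 3, (‖fderiv ℝ φ x (EuclideanSpace.single k (1 : ℝ))‖₊ : ENNReal) ^ 2) +
                (∑ j ∈ S, v (dist x (Y j))) * (‖φ x‖₊ : ENNReal) ^ 2))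
    (hcc : (∃ C₀ : ℝ, 0 < C₀ ∧ ∀ (a : Fin 3 → ℝ) (s m w : ℝ), 0 ≤ s → 0 ≤ m → 0 < w →
      ∃ χ η : EuclideanSpace ℝ (Fin 3) → ℝ,
        ContDiff ℝ 1 χ ∧ ContDiff ℝ 1 η ∧ (∀ x, χ x ^ 2 + η x ^ 2 = 1) ∧
        (∀ x : EuclideanSpace ℝ (Fin 3), (∀ j, x j ∈ Set.Icc (a j - m) (a j + s + m)) → χ x = 1) ∧
        (∀ x : EuclideanSpace ℝ (Fin 3), (∃ j, x j ∉ Set.Ioo (a j - m - w) (a j + s + m + w)) →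
            χ x = 0 ∧ fderiv ℝ χ x = 0 ∧ fderiv ℝ η x = 0) ∧
        (∀ x, ‖fderiv ℝ χ x‖ ^ 2 + ‖fderiv ℝ η x‖ ^ 2 ≤ C₀ / w ^ 2)) ∧
    (∀ (N : ℕ) (a : Fin 3 → ℝ) (s R : ℝ), 0 < s → 0 < R →
      ∀ X : Fin N → EuclideanSpace ℝ (Fin 3),
        ((Finset.univ.filter fun i : Fin N =>
            (∀ j, X i j ∈ Set.Ico (a j) (a j + s)) ∧
              ∀ i' : Fin N, i' ≠ i → (∀ j, X i' j ∈ Set.Ico (a j) (a j + s)) → R ≤ dist (X i) (X i')).card : ℝ) ≤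
          ((⌈2 * s / R⌉₊ : ℝ) + 1) ^ 3))
    (v : ℝ → ℝ≥0∞) (hv : IsRepulsiveFiniteRange v)
    (hnz : ¬ ∀ᵐ r : ℝ ∂(MeasureTheory.volume.restrict (Set.Ioi (0 : ℝ))), v r = 0)
    (hins : ∀ κ : ℝ, 0 < κ → ∃ ρ₁ : ℝ, 0 < ρ₁ ∧ ∀ ρ : ℝ, 0 < ρ → ρ < ρ₁ → ∀ᶠ n : ℕ in Filter.atTop,
      groundStateEnergy v (n + 1) (sideLength ρ (n + 1)) ≤ groundStateEnergy v n (sideLength ρ (n + 1)) + ENNReal.ofReal κ) :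
    ∃ ρ₀ : ℝ, 0 < ρ₀ ∧ ∀ ρ : ℝ, 0 < ρ → ρ < ρ₀ → ∃ l : ℝ, 0 < l ∧ ∃ C : ℝ, ∀ᶠ n : ℕ in Filter.atTop,
      ∃ δ : ENNReal, 0 < δ ∧ ∀ Ψ : TrialState (n + 1) (sideLength ρ (n + 1)),
      energy v Ψ ≤ groundStateEnergy v (n + 1) (sideLength ρ (n + 1)) + δ →
      ENNReal.ofReal (∑ k : Fin 3 → Fin ⌈sideLength ρ (n + 1) / l⌉₊,
        ((⌈sideLength ρ (n + 1) / l⌉₊ : ℝ) ^ 3)⁻¹ * klFun ((⌈sideLength ρ (n + 1) / l⌉₊ : ℝ) ^ 3 *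
          (∫ x in {y : EuclideanSpace ℝ (Fin 3) | ∀ j, y j ∈ Set.Ico (((k j : ℕ) : ℝ) *
            (sideLength ρ (n + 1) / (⌈sideLength ρ (n + 1) / l⌉₊ : ℝ)))
            ((((k j : ℕ) : ℝ) + 1) * (sideLength ρ (n + 1) / (⌈sideLength ρ (n + 1) / l⌉₊ : ℝ)))},
            ∫ Y' : Config n, ‖Ψ.ψ (Matrix.vecCons x Y')‖ ^ 2))) ≤ ENNReal.ofReal C := by
  classical
  obtain ⟨R, hR, β, hβ, hcg⟩ := hcage v hv.1 hnz
  obtain ⟨⟨C₀, hC₀, hcut⟩, hcount⟩ := hcc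
  obtain ⟨ρE, hρE, hE⟩ := energyPerParticleBound_proof v hv
  set κ : ℝ := β / 108 with hκdef
  have hκ : 0 < κ := by positivity
  obtain ⟨ρ₁, hρ₁, hI⟩ := hins κ hκ
  refine ⟨min ρE ρ₁, lt_min hρE hρ₁, fun ρ hρ hρlt => ?_⟩
  obtain ⟨K, hK⟩ := hE ρ hρ (hρlt.trans_le (min_le_left _ _))
  have hIρ := hI ρ hρ (hρlt.trans_le (min_le_right _ _))
  -- the cell side `l`
  set l : ℝ := max (28 * R) (Real.sqrt (5184 * C₀ / β) + 1) with hldef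
  have hl : 0 < l := lt_max_of_lt_left (by positivity)
  have hlR : 28 * R ≤ l := le_max_left _ _
  have hl2 : 5184 * C₀ / β ≤ l ^ 2 := by
    have h1 : Real.sqrt (5184 * C₀ / β) + 1 ≤ l := le_max_right _ _
    have h0 : 0 ≤ Real.sqrt (5184 * C₀ / β) := Real.sqrt_nonneg _
    calc 5184 * C₀ / β = (Real.sqrt (5184 * C₀ / β)) ^ 2 := (Real.sq_sqrt (by positivity)).symm
      _ ≤ l ^ 2 := pow_le_pow_left₀ h0 (by linarith) 2
  set γ : ℝ := ((⌈2 * l / R⌉₊ : ℝ) + 1) ^ 3 with hγdef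
  have hγ0 : 0 ≤ γ := by positivity
  set Λ : ℝ := 16 * (1 + γ) / (ρ * l ^ 3) with hΛdef
  refine ⟨l, hl, max (Real.log Λ) 0 + 1, ?_⟩
  have hK' : ∀ᶠ n : ℕ in atTop, groundStateEnergy v (n + 1) (sideLength ρ (n + 1)) ≤
      ENNReal.ofReal (K * ((n + 1 : ℕ) : ℝ)) := (tendsto_add_atTop_nat 1).eventually hK
  filter_upwards [hIρ, hK', eventually_ge_atTop ⌈ρ * l ^ 3⌉₊] with n hins_n hKn hn
  set L := sideLength ρ (n + 1) with hLdef
  have hNpos : (0 : ℝ) < ((n + 1 : ℕ) : ℝ) := by exact_mod_cast Nat.succ_pos n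
  have hL : 0 < L := Real.rpow_pos_of_pos (div_pos hNpos hρ) _
  have hL3 : L ^ 3 = ((n + 1 : ℕ) : ℝ) / ρ := by
    have h := div_sideLength_pow_three hρ (Nat.succ_pos n)
    rw [← hLdef, div_eq_iff (pow_pos hL 3).ne'] at h
    rw [eq_div_iff hρ.ne', h]
    ring
  -- `L ≥ l`
  have hLl : l ≤ L := by
    by_contra hlt
    push Not at hlt
    have h3 : L ^ 3 < l ^ 3 := pow_lt_pow_left₀ hlt hL.le (by norm_num)
    rw [hL3, div_lt_iff₀ hρ] at h3
    have h4 : ρ * l ^ 3 ≤ (n : ℝ) := (Nat.le_ceil _).trans (by exact_mod_cast hn)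
    push_cast at h3
    linarith
  -- the tiling
  set M := ⌈L / l⌉₊ with hMdef
  have hM : 1 ≤ M := Nat.one_le_iff_ne_zero.2 (Nat.ceil_pos.2 (div_pos hL hl)).ne'
  have hMpos : (0 : ℝ) < M := by exact_mod_cast hM
  set s := L / M with hsdef
  have hs0 : 0 < s := div_pos hL hMpos
  have hsl : s ≤ l := by
    rw [hsdef, div_le_iff₀ hMpos]
    have h := Nat.le_ceil (L / l)
    rw [div_le_iff₀ hl] at h
    linarith
  have hls : l / 2 ≤ s := by
    have hM1 : (M : ℝ) < L / l + 1 := Nat.ceil_lt_add_one (div_nonneg hL.le hl.le)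
    rw [hsdef, le_div_iff₀ hMpos]
    have h1 : l / 2 * (M : ℝ) ≤ l / 2 * (L / l + 1) := by gcongr
    have h2 : l / 2 * (L / l + 1) = L / 2 + l / 2 := by field_simp
    linarith
  have hMs : (M : ℝ) * s = L := by rw [hsdef]; field_simp
  have hRs : 14 * R ≤ s := by linarith
  -- `δ`
  refine ⟨ENNReal.ofReal (β / ((n + 1 : ℕ) : ℝ)), ENNReal.ofReal_pos.2 (by positivity), fun Ψ hΨ => ?_⟩
  have hEtop : groundStateEnergy v (n + 1) L ≠ ⊤ := ne_top_of_le_ne_top ENNReal.ofReal_ne_top hKn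
  -- `ℝ≥0∞` cell masses and the densest cell
  set Pe : (Fin 3 → Fin M) → ℝ≥0∞ := fun k => ∫⁻ X : Config (n + 1),
    ({y : Space | ∀ j, y j ∈ Set.Ico (((k j : ℕ) : ℝ) * s) ((((k j : ℕ) : ℝ) + 1) * s)}).indicator
      (fun _ => (1 : ℝ≥0∞)) (X 0) * (‖Ψ.ψ X‖₊ : ℝ≥0∞) ^ 2 with hPedef
  haveI : Nonempty (Fin 3 → Fin M) := ⟨fun _ => ⟨0, hM⟩⟩
  obtain ⟨k₀, -, hk₀⟩ := Finset.exists_max_image Finset.univ Pe Finset.univ_nonempty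
  have hPk : ∀ k, Pe k ≤ Pe k₀ := fun k => hk₀ k (Finset.mem_univ k)
  have hPe1 : ∀ k, Pe k ≤ 1 := fun k => by
    calc Pe k ≤ ∫⁻ X, (‖Ψ.ψ X‖₊ : ℝ≥0∞) ^ 2 := lintegral_mono fun X => by
            calc _ ≤ 1 * (‖Ψ.ψ X‖₊ : ℝ≥0∞) ^ 2 := by
                  gcongr
                  exact Set.indicator_apply_le' (fun _ => le_rfl) (fun _ => zero_le_one)
              _ = _ := one_mul _
      _ = 1 := Ψ.norm_eq
  have hPtop : Pe k₀ ≠ ⊤ := ne_top_of_le_ne_top ENNReal.one_ne_top (hPe1 k₀)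
  -- MAIN CLAIM: the densest cell holds at most `2(1+γ)` expected particles
  have hmain : ((n + 1 : ℕ) : ℝ≥0∞) * Pe k₀ ≤ ENNReal.ofReal (2 * (1 + γ)) := by
    set a : Fin 3 → ℝ := fun j => ((k₀ j : ℕ) : ℝ) * s with hadef
    set A : Set Space := {y : Space | ∀ j, y j ∈ Set.Ico (a j) (a j + s)} with hAdef
    have hAcell : {y : Space | ∀ j, y j ∈ Set.Ico (((k₀ j : ℕ) : ℝ) * s) ((((k₀ j : ℕ) : ℝ) + 1) * s)} = A :=
      cell_eq_corner k₀ s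
    have hAm : MeasurableSet A := by rw [← hAcell]; exact CoarseChainRule.measurableSet_cell s k₀
    set T : Set Space := {x : Space | ∀ j, x j ∈ Set.Icc (a j - 7 * R) (a j + s + 7 * R)} with hTdef
    have hTm : MeasurableSet T := CoarseChainRule.measurableSet_setOf_forall_mem fun _ => measurableSet_Icc
    set B : Set Space := {x : Space | ∀ j, x j ∈ Set.Ioo (a j - 7 * R - s / 2) (a j + s + 7 * R + s / 2)} with hBdef
    -- the cutoff pair adapted to `A`
    obtain ⟨χ, η, hχ, hη, hχη, hone, hoff, hgrad⟩ :=
      hcut a s (7 * R) (s / 2) hs0.le (by positivity) (half_pos hs0)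
    have hT1 : ∀ x ∈ T, χ x = 1 := fun x hx => hone x hx
    have hBoff : ∀ x, x ∉ B → χ x = 0 ∧ fderiv ℝ χ x = 0 ∧ fderiv ℝ η x = 0 := by
      intro x hx
      refine hoff x ?_
      simpa [hBdef] using hx
    set G : ℝ := C₀ / (s / 2) ^ 2 with hGdef
    have hG0 : 0 ≤ G := by positivity
    have hGβ : 81 * G ≤ β / 4 := by
      have h1 : G ≤ 16 * C₀ / l ^ 2 := by
        rw [hGdef, div_le_div_iff₀ (by positivity) (by positivity)]
        have : l ^ 2 ≤ 16 * (s / 2) ^ 2 := by nlinarith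
        nlinarith
      have h2 : 16 * C₀ / l ^ 2 ≤ β / 324 := by
        rw [div_le_div_iff₀ (by positivity) (by norm_num)]
        rw [div_le_iff₀ hβ] at hl2
        nlinarith
      linarith
    -- one-particle local energy bound
    have hleb := hLEB n L v hv.1 (hfloor (n + 1) L v hv.1) χ η hχ hη hχη G hgrad B hBoff T hT1
      (ENNReal.ofReal κ) (ENNReal.ofReal (β / ((n + 1 : ℕ) : ℝ))) hEtop hins_n Ψ hΨ
    -- fibrewise caging
    have hballT : ∀ y ∈ A, Metric.ball y (7 * R) ⊆ T := fun y hy => ball_subset_margin hy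
    have hcag := hfib v hv.1 R β hR hβ hcg n L Ψ A T hAm hTm hballT
    -- Bose symmetry and the isolated-point count
    have hγs : ((⌈2 * s / R⌉₊ : ℝ) + 1) ^ 3 ≤ γ := by
      have h1 : 2 * s / R ≤ 2 * l / R := by gcongr
      have h2 : (⌈2 * s / R⌉₊ : ℝ) ≤ ⌈2 * l / R⌉₊ := by exact_mod_cast Nat.ceil_mono h1
      rw [hγdef]
      gcongr
    have hiso := fun X : Config (n + 1) =>
      sum_indicator_isolated_le (N := n + 1) (a := a) (s := s) (R := R) (γ := γ)
        (fun X => (hcount (n + 1) a s R hs0 hR X).trans hγs) X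
    have hsc := hsym n L Ψ A hAm R γ hγ0 hiso
    -- the block around the densest cell
    have hbl := hblk n L s hs0 M hMs Ψ k₀ (Pe k₀) hPk
    have hBB : ∫⁻ X : Config (n + 1), B.indicator (fun _ => (1 : ℝ≥0∞)) (X 0) * (‖Ψ.ψ X‖₊ : ℝ≥0∞) ^ 2 ≤
        27 * Pe k₀ := by
      refine le_trans (lintegral_mono fun X => ?_) hbl
      gcongr
      exact nbhd_subset_block k₀ hRs
    -- arithmetic
    have hPA : Pe k₀ = ∫⁻ X : Config (n + 1), A.indicator (fun _ => (1 : ℝ≥0∞)) (X 0) * (‖Ψ.ψ X‖₊ : ℝ≥0∞) ^ 2 := by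
      simp only [hPedef]
      rw [hAcell]
    rw [hPA]
    rw [hPA] at hBB hPtop
    exact densest_arith hβ hPtop hcag hleb hBB hsc (by rw [hκdef]; linarith) hGβ hκ.le hG0 hγ0
  -- from the main claim to the coarse entropy bound
  have hcellR : ∀ k : Fin 3 → Fin M,
      ∫ x in {y : Space | ∀ j, y j ∈ Set.Ico (((k j : ℕ) : ℝ) * s) ((((k j : ℕ) : ℝ) + 1) * s)},
        ∫ Y : Config n, ‖Ψ.ψ (Matrix.vecCons x Y)‖ ^ 2 = (Pe k).toReal := fun k =>
    setIntegral_oneBody_eq_toReal Ψ (CoarseChainRule.measurableSet_cell s k)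
  have hΛk : ∀ k : Fin 3 → Fin M, (M : ℝ) ^ 3 *
      (∫ x in {y : Space | ∀ j, y j ∈ Set.Ico (((k j : ℕ) : ℝ) * s) ((((k j : ℕ) : ℝ) + 1) * s)},
        ∫ Y : Config n, ‖Ψ.ψ (Matrix.vecCons x Y)‖ ^ 2) ≤ Λ := by
    intro k
    rw [hcellR k]
    have h1 : (Pe k).toReal ≤ 2 * (1 + γ) / ((n + 1 : ℕ) : ℝ) := by
      have h2 : ((n + 1 : ℕ) : ℝ≥0∞) * Pe k ≤ ENNReal.ofReal (2 * (1 + γ)) :=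
        le_trans (by gcongr; exact hPk k) hmain
      have h3 : (((n + 1 : ℕ) : ℝ≥0∞) * Pe k).toReal ≤ 2 * (1 + γ) :=
        ENNReal.toReal_le_of_le_ofReal (by positivity) h2
      rw [ENNReal.toReal_mul, ENNReal.toReal_natCast] at h3
      rw [le_div_iff₀ hNpos]
      linarith
    have hM3 : (M : ℝ) ^ 3 * s ^ 3 = ((n + 1 : ℕ) : ℝ) / ρ := by
      rw [← mul_pow, hMs, hL3]
    exact cellMass_arith hNpos hρ hs0 hl hM3 hls h1 hγ0 (by positivity)
  have hcard : (Fintype.card (Fin 3 → Fin M) : ℝ) = (M : ℝ) ^ 3 := by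
    rw [Fintype.card_fun, Fintype.card_fin, Fintype.card_fin]; push_cast; ring
  have hsum : ∑ k : Fin 3 → Fin M,
      ∫ x in {y : Space | ∀ j, y j ∈ Set.Ico (((k j : ℕ) : ℝ) * s) ((((k j : ℕ) : ℝ) + 1) * s)},
        ∫ Y : Config n, ‖Ψ.ψ (Matrix.vecCons x Y)‖ ^ 2 ≤ 1 := by
    exact sum_cellMass_le_one hs0 Ψ
  refine ENNReal.ofReal_le_ofReal ?_
  exact coarse_sum_le hcard (by positivity)
    (fun k => integral_nonneg fun x => integral_nonneg fun Y => sq_nonneg _) hsum hΛk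

end DenseCell

/-- **Registered stub `stub_denseCellBound` (lead).** The dense-cell bound: Dirichlet floor + one-body caging bound +
cutoff pair / isolated-point count + the insertion bound for `v` (not a.e. zero) give the coarse occupation-law entropy
bound for `v` — `DenseCell.denseCell_core` with the landed helper stubs `stub_localEnergyBound`, `stub_fibreCaging`,
`stub_symmCount`, `stub_blockMass`. [folklore] -/
theorem stub_denseCellBound :
    (∀ (N : ℕ) (L : ℝ) (v : ℝ → ENNReal), Measurable v →
      ∀ f : Literature.MathematicalPhysics.QuantumManyBody.BoseGas.Config N → ℂ, ContDiff ℝ 1 f →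
        (∀ X, X ∉ Literature.MathematicalPhysics.QuantumManyBody.BoseGas.boxN N L → f X = 0) →
        Literature.MathematicalPhysics.QuantumManyBody.BoseGas.groundStateEnergy v N L *
            ∫⁻ X, (‖f X‖₊ : ENNReal) ^ 2 ≤
          ∫⁻ X, (Literature.MathematicalPhysics.QuantumManyBody.BoseGas.kineticDensity f X +
            Literature.MathematicalPhysics.QuantumManyBody.BoseGas.interaction v X * (‖f X‖₊ : ENNReal) ^ 2)) →
    (∀ v : ℝ → ENNReal, Measurable v →
      (¬ ∀ᵐ r : ℝ ∂(MeasureTheory.volume.restrict (Set.Ioi (0 : ℝ))), v r = 0) →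
      ∃ R : ℝ, 0 < R ∧ ∃ β : ℝ, 0 < β ∧
        ∀ (m : ℕ) (Y : Fin m → EuclideanSpace ℝ (Fin 3)) (S : Finset (Fin m))
          (T : Set (EuclideanSpace ℝ (Fin 3))), MeasurableSet T →
          (∀ j ∈ S, Metric.ball (Y j) (7 * R) ⊆ T) →
          ∀ φ : EuclideanSpace ℝ (Fin 3) → ℂ, ContDiff ℝ 1 φ → HasCompactSupport φ →
            ENNReal.ofReal β * ∫⁻ x in ⋃ j ∈ S, Metric.ball (Y j) R, (‖φ x‖₊ : ENNReal) ^ 2 ≤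
              ∫⁻ x in T, ((∑ k : Fin 3, (‖fderiv ℝ φ x (EuclideanSpace.single k (1 : ℝ))‖₊ : ENNReal) ^ 2) +
                (∑ j ∈ S, v (dist x (Y j))) * (‖φ x‖₊ : ENNReal) ^ 2)) →
    ((∃ C₀ : ℝ, 0 < C₀ ∧ ∀ (a : Fin 3 → ℝ) (s m w : ℝ), 0 ≤ s → 0 ≤ m → 0 < w →
      ∃ χ η : EuclideanSpace ℝ (Fin 3) → ℝ,
        ContDiff ℝ 1 χ ∧ ContDiff ℝ 1 η ∧ (∀ x, χ x ^ 2 + η x ^ 2 = 1) ∧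
        (∀ x : EuclideanSpace ℝ (Fin 3), (∀ j, x j ∈ Set.Icc (a j - m) (a j + s + m)) → χ x = 1) ∧
        (∀ x : EuclideanSpace ℝ (Fin 3), (∃ j, x j ∉ Set.Ioo (a j - m - w) (a j + s + m + w)) →
            χ x = 0 ∧ fderiv ℝ χ x = 0 ∧ fderiv ℝ η x = 0) ∧
        (∀ x, ‖fderiv ℝ χ x‖ ^ 2 + ‖fderiv ℝ η x‖ ^ 2 ≤ C₀ / w ^ 2)) ∧
    (∀ (N : ℕ) (a : Fin 3 → ℝ) (s R : ℝ), 0 < s → 0 < R →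
      ∀ X : Fin N → EuclideanSpace ℝ (Fin 3),
        ((Finset.univ.filter fun i : Fin N =>
            (∀ j, X i j ∈ Set.Ico (a j) (a j + s)) ∧
              ∀ i' : Fin N, i' ≠ i → (∀ j, X i' j ∈ Set.Ico (a j) (a j + s)) → R ≤ dist (X i) (X i')).card : ℝ) ≤
          ((⌈2 * s / R⌉₊ : ℝ) + 1) ^ 3)) →
    ∀ v : ℝ → ENNReal, Literature.MathematicalPhysics.QuantumManyBody.BoseGas.IsRepulsiveFiniteRange v →
      (¬ ∀ᵐ r : ℝ ∂(MeasureTheory.volume.restrict (Set.Ioi (0 : ℝ))), v r = 0) →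
      (∀ κ : ℝ, 0 < κ → ∃ ρ₁ : ℝ, 0 < ρ₁ ∧ ∀ ρ : ℝ, 0 < ρ → ρ < ρ₁ →
        ∀ᶠ n : ℕ in Filter.atTop,
          Literature.MathematicalPhysics.QuantumManyBody.BoseGas.groundStateEnergy v (n + 1)
              (Literature.MathematicalPhysics.QuantumManyBody.BoseGas.sideLength ρ (n + 1)) ≤
            Literature.MathematicalPhysics.QuantumManyBody.BoseGas.groundStateEnergy v n
              (Literature.MathematicalPhysics.QuantumManyBody.BoseGas.sideLength ρ (n + 1)) + ENNReal.ofReal κ) →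
      ∃ ρ₀ : ℝ, 0
      < ρ₀ ∧ ∀ ρ : ℝ, 0 < ρ → ρ < ρ₀ → ∃ l : ℝ, 0 < l ∧ ∃ C : ℝ, ∀ᶠ n : ℕ in Filter.atTop, ∃ δ :
      ENNReal, 0 < δ ∧ ∀ Ψ : Literature.MathematicalPhysics.QuantumManyBody.BoseGas.TrialState (n +
      1) (Literature.MathematicalPhysics.QuantumManyBody.BoseGas.sideLength ρ (n + 1)),
      Literature.MathematicalPhysics.QuantumManyBody.BoseGas.energy v Ψ ≤
      Literature.MathematicalPhysics.QuantumManyBody.BoseGas.groundStateEnergy v (n + 1)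
      (Literature.MathematicalPhysics.QuantumManyBody.BoseGas.sideLength ρ (n + 1)) + δ →
      ENNReal.ofReal (∑ k : Fin 3 → Fin
      ⌈Literature.MathematicalPhysics.QuantumManyBody.BoseGas.sideLength ρ (n + 1) / l⌉₊,
      ((⌈Literature.MathematicalPhysics.QuantumManyBody.BoseGas.sideLength ρ (n + 1) / l⌉₊ : ℝ) ^
      3)⁻¹ * InformationTheory.klFun
      ((⌈Literature.MathematicalPhysics.QuantumManyBody.BoseGas.sideLength ρ (n + 1) / l⌉₊ : ℝ) ^ 3
      * (∫ x in {y : EuclideanSpace ℝ (Fin 3) | ∀ j, y j ∈ Set.Ico (((k j : ℕ) : ℝ) *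
      ((Literature.MathematicalPhysics.QuantumManyBody.BoseGas.sideLength ρ (n + 1)) /
      (⌈Literature.MathematicalPhysics.QuantumManyBody.BoseGas.sideLength ρ (n + 1) / l⌉₊ : ℝ)))
      ((((k j : ℕ) : ℝ) + 1) * ((Literature.MathematicalPhysics.QuantumManyBody.BoseGas.sideLength
      ρ (n + 1)) / (⌈Literature.MathematicalPhysics.QuantumManyBody.BoseGas.sideLength ρ (n + 1) /
      l⌉₊ : ℝ)))}, ∫ Y' : Literature.MathematicalPhysics.QuantumManyBody.BoseGas.Config n, ‖Ψ.ψ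
      (Matrix.vecCons x Y')‖ ^ 2))) ≤ ENNReal.ofReal C :=
  fun hfloor hcage hcc v hv hnz hins =>
    DenseCell.denseCell_core stub_localEnergyBound stub_fibreCaging stub_symmCount stub_blockMass
      hfloor hcage hcc v hv hnz hins

end Summit.AtomisticToContinuum.BoseEinsteinCondensation.Cruxes.OneBodyEntropyBound.Birth

end
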